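import Summits.ResolutionOfSingularities.ResolutionOfSingularities.Theorems.MarkedTransferCampaignW46WWalkModel
import HarnessLib

/-!
# [OURS · L1 W4.6 rung (iii-2)] THE W-WALK MODEL COMMUTES WITH COEFFICIENT EXTENSION

Cell `res-hironaka`, LADDER-RESOLUTION rung L (D-0089), slot W4.6 rung (iii); seat res-L1-s46-pv-5 (gen 7). Host route MarkedTransfer,
`--supports stmt-ResolutionOfSingularities-16155 --as helper`; kind proof (def-free). Plan `HOME/L/res-L1-s46-pv-5/NOTES.md` (gen 7, file F2).

WHY. Over a perfect NON-closed ground field the coefficient fields of the Cohen anchors GROW along a hit thread (`L_k ⊆ L_{k+1}`, the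
residue field of the thread point). The combinatorics of the W-walk (`…WWalkCombinatorics.eventually_tStep`) and its endgame
(`…WWalkEndgame.false_of_tTail`) run over ONE field; gen 7 runs them in `Ω⟦t, y, z⟧`, `Ω` an algebraic closure, reading each model state
through the embedding `L_k → Ω`. This file records that the model vocabulary of `…WWalkModel` (all of it defined COEFFICIENTWISE with
integer coefficients) commutes with `MvPowerSeries.map` along any ring map, and that the predicates `BDiv`, `LowVanish`, `YAdapted`,
`TAdapted`, `NDz` are INVARIANT under injective coefficient maps (the order: res-L1-s46-pv-6's `order_map_of_injective`).

HONEST FRAMING. OURS; nothing here is a statement of H. Hironaka's manuscript [Hironaka2017] and nothing of it is used. AI-written; AI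
review is weaker than expert review. No `sorry`; axioms standard. [folklore]
-/

noncomputable section

set_option linter.dupNamespace false -- mandated namespace of this single-conjunct summit

open MvPowerSeries Finset

namespace Summit.ResolutionOfSingularities.ResolutionOfSingularities.Theorems

namespace CampaignW46

namespace WWalk

variable {K K' : Type*} [CommRing K] [CommRing K'] (φ : K →+* K')

/-! ## §1 The operations commute with `map φ` -/

/-- `(chartT p l f) ⊗ K′ = chartT p (φ l) (f ⊗ K′)`. [folklore] -/
theorem map_chartT (p : ℕ) (l : K) (f : MvPowerSeries (Option (Fin 2)) K) :
    MvPowerSeries.map φ (chartT p l f) = chartT p (φ l) (MvPowerSeries.map φ f) := by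
  ext e
  rw [coeff_map, ← mk3_eta e, coeff_chartT, coeff_chartT, map_sum]
  refine sum_congr rfl fun b _ => ?_
  split_ifs
  · rw [map_mul, map_mul, map_natCast, map_pow, coeff_map]
  · rw [map_zero]

/-- `(shearZ γ f) ⊗ K′ = shearZ (φ γ) (f ⊗ K′)`. [folklore] -/
theorem map_shearZ (γ : K) (f : MvPowerSeries (Option (Fin 2)) K) :
    MvPowerSeries.map φ (shearZ γ f) = shearZ (φ γ) (MvPowerSeries.map φ f) := by
  ext e
  rw [coeff_map, ← mk3_eta e, coeff_shearZ, coeff_shearZ, map_sum]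
  refine sum_congr rfl fun i _ => ?_
  rw [map_mul, map_mul, map_natCast, map_pow, map_neg, coeff_map]

/-- `(stepT p l γ f) ⊗ K′ = stepT p (φ l) (φ γ) (f ⊗ K′)`. [folklore] -/
theorem map_stepT (p : ℕ) (l γ : K) (f : MvPowerSeries (Option (Fin 2)) K) :
    MvPowerSeries.map φ (stepT p l γ f) = stepT p (φ l) (φ γ) (MvPowerSeries.map φ f) := by
  rw [stepT, stepT, map_shearZ, map_sub, map_chartT, map_mul, MvPowerSeries.map_C, map_pow φ γ p, map_pow (MvPowerSeries.map φ),
    MvPowerSeries.map_X]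

/-- `(swapTY f) ⊗ K′ = swapTY (f ⊗ K′)`. [folklore] -/
theorem map_swapTY (f : MvPowerSeries (Option (Fin 2)) K) :
    MvPowerSeries.map φ (swapTY f) = swapTY (MvPowerSeries.map φ f) := by
  ext e
  rw [coeff_map, ← mk3_eta e, coeff_swapTY, coeff_swapTY, coeff_map]

/-! ## §2 The predicates are invariant under injective coefficient maps -/

section Injective

variable {φ} (hφ : Function.Injective φ)
include hφ

/-- A coefficient of `f ⊗ K′` vanishes iff the coefficient of `f` does. [folklore] -/
theorem coeff_map_eq_zero_iff (f : MvPowerSeries (Option (Fin 2)) K) (e : Option (Fin 2) →₀ ℕ) :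
    coeff e (MvPowerSeries.map φ f) = 0 ↔ coeff e f = 0 := by
  rw [coeff_map, map_eq_zero_iff φ hφ]

/-- `BDiv` is invariant. [folklore] -/
theorem bdiv_map_iff {rt ry : ℕ} {f : MvPowerSeries (Option (Fin 2)) K} :
    BDiv rt ry (MvPowerSeries.map φ f) ↔ BDiv rt ry f := by
  simp only [BDiv, ne_eq, coeff_map_eq_zero_iff hφ]

/-- `LowVanish` is invariant. [folklore] -/
theorem lowVanish_map_iff {n : ℕ} {f : MvPowerSeries (Option (Fin 2)) K} :
    LowVanish n (MvPowerSeries.map φ f) ↔ LowVanish n f := by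
  simp only [LowVanish, coeff_map_eq_zero_iff hφ]

/-- `YAdapted` is invariant. [folklore] -/
theorem yAdapted_map_iff {rt d : ℕ} {f : MvPowerSeries (Option (Fin 2)) K} :
    YAdapted rt d (MvPowerSeries.map φ f) ↔ YAdapted rt d f := by
  simp only [YAdapted, ne_eq, coeff_map_eq_zero_iff hφ]

/-- `TAdapted` is invariant. [folklore] -/
theorem tAdapted_map_iff {ry d : ℕ} {f : MvPowerSeries (Option (Fin 2)) K} :
    TAdapted ry d (MvPowerSeries.map φ f) ↔ TAdapted ry d f := by
  simp only [TAdapted, ne_eq, coeff_map_eq_zero_iff hφ]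

/-- (ND) is invariant. [folklore] -/
theorem ndz_map_iff {d : ℕ} {f : MvPowerSeries (Option (Fin 2)) K} :
    NDz d (MvPowerSeries.map φ f) ↔ NDz d f := by
  simp only [NDz, ne_eq, coeff_map_eq_zero_iff hφ]

end Injective

end WWalk

end CampaignW46

end Summit.ResolutionOfSingularities.ResolutionOfSingularities.Theorems

end
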